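import Mathlib
import HarnessLib
import Literature.NumberTheory.DiophantineGeometry.WronskianRamification
import Literature.NumberTheory.DiophantineGeometry.BelyiWitnessExtremal
import Literature.NumberTheory.DiophantineGeometry.Mason1984.ProjectiveMasonStothers

/-!
# The three-point Riemann–Hurwitz count for a rational map `p/q : ℙ¹ → ℙ¹`

Topic `Literature/NumberTheory/DiophantineGeometry`; sequel of `WronskianRamification.lean` (exact
Wronskian multiplicities at the special points and the degree of the Wronskian at `∞`) and companion
of `BelyiWitnessExtremal.lean` / `Mason1984/ProjectiveMasonStothers.lean`, which both record:
*"The converse direction (equality iff every critical value of `p/q` lies in `{0,1,∞}`) is not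
formalised here"* / *"Equality … characterises Belyi maps (Riemann–Hurwitz); that converse is NOT
formalised here."*  This file proves that converse, i.e. the **counting lemma for Belyi maps on
`ℙ¹`**, in the tree's `(p, q)` format for rational functions (`BelyiLemma.lean`, `BelyiDegree.lean`):
over an algebraically closed field `K` of characteristic `0`, for coprime `p, q ∈ K[X]` with
`d = max (deg p) (deg q) ≥ 1` and Wronskian `W = p q' − p' q` (`Polynomial.wronskian`), ASSUME the
finite critical values of `p/q` lie in `{0, 1}`:

  `∀ z, q(z) ≠ 0 → W(z) = 0 → p(z) = 0 ∨ p(z) = q(z)`                                  (B)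

(the clause of `BelyiLemmaGenusZero`; finite points over `∞` need no condition).  Then

* `card_roots_add_natDegree_wronskian` — **the identity**
  `#Z(p·q·(p−q)) + deg W = deg p + deg q + deg (p − q)` (every root of `W` is special, of exact
  multiplicity `e_s − 1`: `rootMultiplicity_wronskian_of_isRoot_prod`);
* `card_roots_eq_succ_of_drop` — **`∞` special** (one of `deg p, deg q, deg (p − q)` is `< d`, i.e.
  `(p/q)(∞) ∈ {0, ∞, 1}`): `#Z(p·q·(p−q)) = d + 1`; packaged as `isBelyiPair_of_criticalValues :
  IsBelyiPair d p q` and, over `ℂ`, `hasBelyiWitness_of_criticalValues` /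
  `belyiDegree_le_of_criticalValues` (the remark "by the Riemann–Hurwitz count — not proved here"
  of `BelyiDegree.lean` / `BelyiLemma.lean`);
* `add_two_le_card_roots`, `card_roots_eq_add_two_iff`, `card_roots_eq_add_two_of_unramified_infty`
  — **`∞` generic** (`deg p = deg q = deg (p − q) = d`, i.e. `(p/q)(∞) ∉ {0, 1, ∞}`):
  `#Z(p·q·(p−q)) ≥ d + 2`, with equality iff `deg W = 2d − 2` iff `p/q` is unramified at `∞`
  (`natDegree_wronskian_eq_iff_unramified_infty`, `natDegree_sub_C_mul_eq_iff_coeff` of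
  `WronskianRamification.lean`), i.e. `|β⁻¹{0,1,∞}| = deg β + 2` for a Belyi map NONCRITICAL AT
  `∞` — the count used by the noncritical Belyi maps of Scherr–Zieve / Mochizuki [NCBelyi] (route
  `IUTThetaPilot`, support item `GenEllTwo`: GENELLTWO-P1ROUTE §3 (e) "`|B| = deg β + 2`");
* the same two counts in the `radical` language of `Polynomial.abc`
  (`natDegree_radical_eq_succ_of_drop`, `natDegree_radical_eq_add_two_of_unramified_infty`);
* `card_roots_map_eq_succ_of_belyiClauses` — over `ℚ`, read in `ℂ`, with the clause shapes of
  `BelyiLemmaGenusZero` verbatim (`derivative p * q - p * derivative q = −W`).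

Sources formalised: W. Goldring, *Unifying themes suggested by Belyi's theorem* (2011), Thm 3.2
[cite: Goldring2011, Thm 3.2]: "Equality holds in (3.0.6) [`h(e,f,g) ≤ r(efg) − 1`, Mason–Stothers]
if and only if `f/g` is a Belyi map for `ℙ¹` and `(f/g)(∞) ∈ {0, 1, ∞}`" (we prove the direction
Belyi ⟹ equality, i.e. `r = h + 1`; the other direction is `BelyiWitnessExtremal` /
`Mason1984.mason_projective`), with its proof's case `deg g = h` giving the `∞`-generic count; and
Z. Scherr, M. Zieve, *Separated Belyi maps* (2014), proof of Prop. 9 [cite: ScherrZieve2014, Prop 9]: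
"`2g − 2 = −2d + Σ_{P∈B}(e(P) − 1) = −2d + 3d − #B`, so that `d = 2g − 2 + #B`" (here `g = 0`:
`#B = d + 2`).  Everything is the genus-`0` Riemann–Hurwitz formula restricted to maps branched over
three points; theorems only, no definitions, no named facts; characteristic `0` throughout.
-/

noncomputable section

namespace Literature.NumberTheory.DiophantineGeometry

open Polynomial

variable {K : Type*} [Field K]

/-! ### The count -/

section Count

variable [IsAlgClosed K] [CharZero K] [DecidableEq K] {p q : K[X]} {d : ℕ}

/-- **Three-point Riemann–Hurwitz identity.**  For coprime `p, q ∈ K[X]` (`K` algebraically closed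
of characteristic `0`) with `max (deg p) (deg q) ≥ 1` whose finite critical values lie in `{0, 1}`
(clause (B)), the number `N` of distinct zeros of `p · q · (p − q)` satisfies
`N + deg (p q' − p' q) = deg p + deg q + deg (p − q)`.  (Genus-`0` Riemann–Hurwitz
`Σ_P (e_P − 1) = 2 deg β − 2` for `β = p/q` branched over `{0,1,∞}`: the affine part of the left side
is `deg W`.) [cite: ScherrZieve2014, Prop 9 (proof)] -/
theorem card_roots_add_natDegree_wronskian (hcop : IsCoprime p q) (hd : 0 < max p.natDegree q.natDegree)
    (hcrit : ∀ z : K, q.eval z ≠ 0 → (wronskian p q).eval z = 0 → p.eval z = 0 ∨ p.eval z = q.eval z) :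
    (p * q * (p - q)).roots.toFinset.card + (wronskian p q).natDegree =
      p.natDegree + q.natDegree + (p - q).natDegree := by
  have hW : wronskian p q ≠ 0 := wronskian_ne_zero_of_isCoprime hcop hd
  have hp : p ≠ 0 := by rintro rfl; exact hW (wronskian_zero_left q)
  have hq : q ≠ 0 := by rintro rfl; exact hW (wronskian_zero_right p)
  have hpq : p - q ≠ 0 := by
    intro h
    rw [sub_eq_zero.mp h, wronskian_self_eq_zero] at hW
    exact hW rfl
  set F := p * q * (p - q) with hF
  have hF0 : F ≠ 0 := mul_ne_zero (mul_ne_zero hp hq) hpq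
  -- the roots of `W` lie among those of `F`
  have hsub : (wronskian p q).roots.toFinset ⊆ F.roots.toFinset := by
    intro s hs
    rw [Multiset.mem_toFinset, mem_roots hW] at hs
    exact Multiset.mem_toFinset.mpr ((mem_roots hF0).mpr (isRoot_prod_of_isRoot_wronskian hcrit hs))
  -- `deg W = Σ_{s ∈ Z(F)} mult_s W = Σ (e_s - 1)` and `deg F = Σ e_s`
  have hWsum := sum_rootMultiplicity_eq_natDegree_of_splits (IsAlgClosed.splits (wronskian p q)) hsub
  have hFsum : ∑ s ∈ F.roots.toFinset, F.rootMultiplicity s = F.natDegree :=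
    sum_rootMultiplicity_eq_natDegree_of_splits (IsAlgClosed.splits F) subset_rfl
  have hFdeg : F.natDegree = p.natDegree + q.natDegree + (p - q).natDegree := by
    rw [hF, natDegree_mul (mul_ne_zero hp hq) hpq, natDegree_mul hp hq]
  have hkey : ∑ s ∈ F.roots.toFinset, F.rootMultiplicity s =
      ∑ s ∈ F.roots.toFinset, (wronskian p q).rootMultiplicity s + F.roots.toFinset.card := by
    rw [Finset.card_eq_sum_ones, ← Finset.sum_add_distrib]
    refine Finset.sum_congr rfl fun s hs => ?_
    have hroot : F.IsRoot s := (mem_roots hF0).mp (Multiset.mem_toFinset.mp hs)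
    rw [rootMultiplicity_wronskian_of_isRoot_prod hcop hp hq hpq hroot, ← hF]
    have := (rootMultiplicity_pos hF0).mpr hroot
    omega
  omega

/-- **`∞` special: the count `d + 1`.**  If moreover one of `deg p, deg q, deg (p − q)` is `< d =
max (deg p) (deg q)` (the point `∞` lies over `0`, `∞` or `1`), then `p · q · (p − q)` has exactly
`d + 1` distinct zeros — together with `∞`, `|β⁻¹{0,1,∞}| = d + 2` for the Belyi map `β = p/q` of
degree `d`.  Converse of `succ_max_natDegree_le_card_roots` (`BelyiWitnessExtremal`). [cite: Goldring2011, Thm 3.2] -/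
theorem card_roots_eq_succ_of_drop (hcop : IsCoprime p q) (hmax : max p.natDegree q.natDegree = d)
    (hdrop : p.natDegree < d ∨ q.natDegree < d ∨ (p - q).natDegree < d)
    (hcrit : ∀ z : K, q.eval z ≠ 0 → (wronskian p q).eval z = 0 → p.eval z = 0 ∨ p.eval z = q.eval z) :
    (p * q * (p - q)).roots.toFinset.card = d + 1 := by
  have hd : 0 < d := by rcases hdrop with h | h | h <;> omega
  have hW : wronskian p q ≠ 0 := wronskian_ne_zero_of_isCoprime hcop (hmax ▸ hd)
  have hp : p ≠ 0 := by rintro rfl; exact hW (wronskian_zero_left q)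
  have hq : q ≠ 0 := by rintro rfl; exact hW (wronskian_zero_right p)
  have hpq : p - q ≠ 0 := by
    intro h
    rw [sub_eq_zero.mp h, wronskian_self_eq_zero] at hW
    exact hW rfl
  have hid := card_roots_add_natDegree_wronskian hcop (hmax ▸ hd) hcrit
  -- in each case `deg W = deg p + deg q + deg (p - q) - d - 1`
  rcases hdrop with h | h | h
  · -- `deg p < d = deg q`, `deg (p - q) = d`
    have hqd : q.natDegree = d := by
      rcases max_choice p.natDegree q.natDegree with hm | hm <;> omega
    have hpqd : (p - q).natDegree = d := by
      rw [natDegree_sub_eq_right_of_natDegree_lt (by omega), hqd]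
    have hWd := natDegree_wronskian_of_natDegree_ne hp hq (by omega)
    omega
  · -- `deg q < d = deg p`, `deg (p - q) = d`
    have hpd : p.natDegree = d := by
      rcases max_choice p.natDegree q.natDegree with hm | hm <;> omega
    have hpqd : (p - q).natDegree = d := by
      rw [natDegree_sub_eq_left_of_natDegree_lt (by omega), hpd]
    have hWd := natDegree_wronskian_of_natDegree_ne hp hq (by omega)
    omega
  · -- `deg (p - q) < d = deg p = deg q`: use `W(p, q) = W(p - q, q)`
    have hpd : p.natDegree = d := by
      by_contra hne
      have hlt : p.natDegree < q.natDegree := by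
        rcases max_choice p.natDegree q.natDegree with hm | hm <;> omega
      have := natDegree_sub_eq_right_of_natDegree_lt hlt
      omega
    have hqd : q.natDegree = d := by
      by_contra hne
      have hlt : q.natDegree < p.natDegree := by omega
      have := natDegree_sub_eq_left_of_natDegree_lt hlt
      omega
    have hWd := natDegree_wronskian_of_natDegree_ne hpq hq (by omega)
    rw [wronskian_sub_self_left] at hWd
    omega

/-- **Belyi clauses ⟹ Belyi pair.**  Coprime `p, q` with `max (deg p) (deg q) = d`, `∞` special and
finite critical values in `{0, 1}` form a Belyi pair of degree `d` in the root-count normal form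
`IsBelyiPair` of `BelyiPairWronskian` (so all the Wronskian calculus there applies). [cite: Goldring2011, Thm 3.2] -/
theorem isBelyiPair_of_criticalValues (hcop : IsCoprime p q) (hmax : max p.natDegree q.natDegree = d)
    (hdrop : p.natDegree < d ∨ q.natDegree < d ∨ (p - q).natDegree < d)
    (hcrit : ∀ z : K, q.eval z ≠ 0 → (wronskian p q).eval z = 0 → p.eval z = 0 ∨ p.eval z = q.eval z) :
    IsBelyiPair d p q := by
  classical
  exact ⟨hcop, hmax, hdrop, by convert card_roots_eq_succ_of_drop hcop hmax hdrop hcrit⟩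

/-- **`∞` generic: at least `d + 2`.**  If `deg p = deg q = deg (p − q) = d ≥ 1` (so `∞` is NOT over
`{0, 1, ∞}`) and the finite critical values lie in `{0, 1}`, then `p · q · (p − q)` has at least
`d + 2` distinct zeros (`= d + 1 + e_∞`). [cite: ScherrZieve2014, Prop 9 (proof)] -/
theorem add_two_le_card_roots (hcop : IsCoprime p q) (hp : p.natDegree = d) (hq : q.natDegree = d)
    (hpq : (p - q).natDegree = d) (hd : 0 < d)
    (hcrit : ∀ z : K, q.eval z ≠ 0 → (wronskian p q).eval z = 0 → p.eval z = 0 ∨ p.eval z = q.eval z) :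
    d + 2 ≤ (p * q * (p - q)).roots.toFinset.card := by
  have hid := card_roots_add_natDegree_wronskian hcop (by rw [hp, hq, max_self]; exact hd) hcrit
  have hle := Mason1984.natDegree_wronskian_le_of_natDegree_eq hd hp hq
  omega

/-- **`∞` generic: the count `d + 2`.**  If `deg p = deg q = deg (p − q) = d ≥ 1` and the finite
critical values of `p/q` lie in `{0, 1}`, then `p · q · (p − q)` has EXACTLY `d + 2` distinct zeros iff
`deg (p q' − p' q) = 2d − 2`, i.e. (`natDegree_wronskian_eq_iff_unramified_infty`) iff `p/q` is
unramified at `∞` — `|β⁻¹{0,1,∞}| = deg β + 2` for a Belyi map `β` on `ℙ¹` that is noncritical at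
`∞`. [cite: ScherrZieve2014, Prop 9 (proof)] -/
theorem card_roots_eq_add_two_iff (hcop : IsCoprime p q) (hp : p.natDegree = d) (hq : q.natDegree = d)
    (hpq : (p - q).natDegree = d) (hd : 0 < d)
    (hcrit : ∀ z : K, q.eval z ≠ 0 → (wronskian p q).eval z = 0 → p.eval z = 0 ∨ p.eval z = q.eval z) :
    (p * q * (p - q)).roots.toFinset.card = d + 2 ↔ (wronskian p q).natDegree = 2 * d - 2 := by
  have hid := card_roots_add_natDegree_wronskian hcop (by rw [hp, hq, max_self]; exact hd) hcrit
  omega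

/-- The same count with "unramified at `∞`" in the form `deg (p − (lc p / lc q)·q) = d − 1`.
[cite: ScherrZieve2014, Prop 9 (proof)] -/
theorem card_roots_eq_add_two_of_unramified_infty (hcop : IsCoprime p q) (hp : p.natDegree = d)
    (hq : q.natDegree = d) (hpq : (p - q).natDegree = d) (hd : 0 < d)
    (hinf : (p - C (p.leadingCoeff / q.leadingCoeff) * q).natDegree = d - 1)
    (hcrit : ∀ z : K, q.eval z ≠ 0 → (wronskian p q).eval z = 0 → p.eval z = 0 ∨ p.eval z = q.eval z) :
    (p * q * (p - q)).roots.toFinset.card = d + 2 :=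
  (card_roots_eq_add_two_iff hcop hp hq hpq hd hcrit).mpr
    ((natDegree_wronskian_eq_iff_unramified_infty hcop hp hq hd).mpr hinf)

/-- The counts in the `radical` language of `Polynomial.abc` (`deg rad f = #Z(f)`,
`natDegree_radical_eq_card_roots`): `∞` special ⟹ `deg rad (p q (p − q)) = d + 1`. [cite: Goldring2011, Thm 3.2] -/
theorem natDegree_radical_eq_succ_of_drop (hcop : IsCoprime p q) (hmax : max p.natDegree q.natDegree = d)
    (hdrop : p.natDegree < d ∨ q.natDegree < d ∨ (p - q).natDegree < d)
    (hcrit : ∀ z : K, q.eval z ≠ 0 → (wronskian p q).eval z = 0 → p.eval z = 0 ∨ p.eval z = q.eval z) :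
    (UniqueFactorizationMonoid.radical (p * q * (p - q))).natDegree = d + 1 := by
  rw [natDegree_radical_eq_card_roots, card_roots_eq_succ_of_drop hcop hmax hdrop hcrit]

/-- `∞` generic and unramified ⟹ `deg rad (p q (p − q)) = d + 2`. [cite: ScherrZieve2014, Prop 9 (proof)] -/
theorem natDegree_radical_eq_add_two_of_unramified_infty (hcop : IsCoprime p q) (hp : p.natDegree = d)
    (hq : q.natDegree = d) (hpq : (p - q).natDegree = d) (hd : 0 < d)
    (hinf : (p - C (p.leadingCoeff / q.leadingCoeff) * q).natDegree = d - 1)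
    (hcrit : ∀ z : K, q.eval z ≠ 0 → (wronskian p q).eval z = 0 → p.eval z = 0 ∨ p.eval z = q.eval z) :
    (UniqueFactorizationMonoid.radical (p * q * (p - q))).natDegree = d + 2 := by
  rw [natDegree_radical_eq_card_roots,
    card_roots_eq_add_two_of_unramified_infty hcop hp hq hpq hd hinf hcrit]

end Count

/-! ### Over `ℚ`, read in `ℂ`: the clause shapes of `BelyiLemmaGenusZero` -/

section Rational

/-- `p' q − p q' = −W(p, q)`: the critical-point polynomial as written in `BelyiLemmaGenusZero` is the
negative of Mathlib's Wronskian. [folklore] -/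
private theorem derivative_mul_sub_mul_derivative_eq_neg_wronskian {R : Type*} [CommRing R] (p q : R[X]) :
    derivative p * q - p * derivative q = -wronskian p q := by
  rw [wronskian]; ring

/-- **Rational Belyi maps through `0, 1, t` are Belyi witnesses.**  Coprime `p, q ∈ ℂ[X]` with
`max (deg p) (deg q) = d`, `∞` special, finite critical values in `{0, 1}` and `0, 1, t` among the
zeros of `p · q · (p − q)` give `HasBelyiWitness d t` (`BelyiDegree.lean`) — the root-count clause
is the three-point Riemann–Hurwitz count. [cite: Goldring2011, Thm 3.2] -/
theorem hasBelyiWitness_of_criticalValues {p q : ℂ[X]} {d : ℕ} (hcop : IsCoprime p q)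
    (hmax : max p.natDegree q.natDegree = d)
    (hdrop : p.natDegree < d ∨ q.natDegree < d ∨ (p - q).natDegree < d)
    (hcrit : ∀ z : ℂ, q.eval z ≠ 0 → (wronskian p q).eval z = 0 → p.eval z = 0 ∨ p.eval z = q.eval z)
    {t : ℂ} (h0 : (p * q * (p - q)).eval 0 = 0) (h1 : (p * q * (p - q)).eval 1 = 0)
    (ht : (p * q * (p - q)).eval t = 0) : HasBelyiWitness d t :=
  ⟨p, q, hcop, hmax, hdrop, card_roots_eq_succ_of_drop hcop hmax hdrop hcrit, h0, h1, ht⟩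

/-- Hence the Belyi degree of `(ℙ¹; 0, 1, ∞, t)` is at most the degree of ANY rational Belyi map
`p/q` with `∞` special through `0, 1, t` (the rational-map generalisation of
`belyiDegree_le_natDegree_of_polynomial`, `BelyiWitnessExistence.lean`). [cite: Goldring2011, Thm 3.2] -/
theorem belyiDegree_le_of_criticalValues {p q : ℂ[X]} (hcop : IsCoprime p q)
    (hdrop : p.natDegree < max p.natDegree q.natDegree ∨ q.natDegree < max p.natDegree q.natDegree ∨
      (p - q).natDegree < max p.natDegree q.natDegree)
    (hcrit : ∀ z : ℂ, q.eval z ≠ 0 → (wronskian p q).eval z = 0 → p.eval z = 0 ∨ p.eval z = q.eval z)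
    {t : ℂ} (h0 : (p * q * (p - q)).eval 0 = 0) (h1 : (p * q * (p - q)).eval 1 = 0)
    (ht : (p * q * (p - q)).eval t = 0) : belyiDegree t ≤ max p.natDegree q.natDegree :=
  belyiDegree_le (hasBelyiWitness_of_criticalValues hcop rfl hdrop hcrit h0 h1 ht)

/-- **The count for the output of Belyi's lemma over `ℚ`.**  Let `p, q ∈ ℚ[X]` be coprime with
`d = max (deg p) (deg q) ≥ 1`, `∞` special, and — read in `ℂ` exactly as in `BelyiLemmaGenusZero` —
every `z ∈ ℂ` with `q(z) ≠ 0` and `(p' q − p q')(z) = 0` has `p(z) = 0` or `p(z) = q(z)`.  Then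
`p · q · (p − q)` has exactly `d + 1` distinct complex zeros; so (with the value clause at `0, 1, t`)
the pair `(p, q)` mapped to `ℂ` is a `HasBelyiWitness d t` (`BelyiDegree.lean`: "a witness exists for
every algebraic `t` … by the Riemann–Hurwitz count — not proved here"). [cite: Goldring2011, Thm 3.2] -/
theorem card_roots_map_eq_succ_of_belyiClauses {p q : ℚ[X]} {d : ℕ} (hcop : IsCoprime p q)
    (hmax : max p.natDegree q.natDegree = d)
    (hdrop : p.natDegree < d ∨ q.natDegree < d ∨ (p - q).natDegree < d)
    (hcrit : ∀ z : ℂ, (q.map (algebraMap ℚ ℂ)).eval z ≠ 0 →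
      ((derivative p * q - p * derivative q).map (algebraMap ℚ ℂ)).eval z = 0 →
        (p.map (algebraMap ℚ ℂ)).eval z = 0 ∨
          (p.map (algebraMap ℚ ℂ)).eval z = (q.map (algebraMap ℚ ℂ)).eval z) :
    ((p * q * (p - q)).map (algebraMap ℚ ℂ)).roots.toFinset.card = d + 1 := by
  have hinj : Function.Injective (algebraMap ℚ ℂ) := (algebraMap ℚ ℂ).injective
  rw [Polynomial.map_mul, Polynomial.map_mul, Polynomial.map_sub]
  refine card_roots_eq_succ_of_drop (hcop.map (mapRingHom (algebraMap ℚ ℂ))) ?_ ?_ ?_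
  · rw [natDegree_map_eq_of_injective hinj, natDegree_map_eq_of_injective hinj, hmax]
  · rw [← Polynomial.map_sub, natDegree_map_eq_of_injective hinj,
      natDegree_map_eq_of_injective hinj, natDegree_map_eq_of_injective hinj]
    exact hdrop
  · intro z hqz hWz
    refine hcrit z hqz ?_
    rw [Polynomial.map_sub, Polynomial.map_mul, Polynomial.map_mul, ← derivative_map,
      ← derivative_map, derivative_mul_sub_mul_derivative_eq_neg_wronskian, eval_neg, neg_eq_zero]
    exact hWz

end Rational

/-! ### Goldring's Theorem 3.2 as an `iff` (appended) -/

section GoldringIff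

variable [IsAlgClosed K] [CharZero K] [DecidableEq K] {p q : K[X]} {d : ℕ}

omit [DecidableEq K] in
/-- **A Belyi pair has its finite critical values in `{0, 1}`** (the direction "equality in
Mason–Stothers ⟹ Belyi" of Goldring's Theorem 3.2): if `p · q · (p − q)` has only `d + 1` distinct
zeros (`IsBelyiPair d p q`), the Wronskian vanishes only at special points
(`IsBelyiPair.rootMultiplicity_wronskian`), so every finite critical point of `p/q` lies over `0` or
`1` (or is a pole). [cite: Goldring2011, Thm 3.2] -/
theorem IsBelyiPair.criticalValues (h : IsBelyiPair d p q) (z : K) (hqz : q.eval z ≠ 0)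
    (hWz : (wronskian p q).eval z = 0) : p.eval z = 0 ∨ p.eval z = q.eval z := by
  have hmult : 0 < (wronskian p q).rootMultiplicity z :=
    (rootMultiplicity_pos h.wronskian_ne_zero).mpr hWz
  rw [h.rootMultiplicity_wronskian] at hmult
  have hroot : (p * q * (p - q)).IsRoot z :=
    (rootMultiplicity_pos h.prod_ne_zero).mp (by omega)
  rw [IsRoot.def, eval_mul, eval_mul, eval_sub, mul_eq_zero, mul_eq_zero, sub_eq_zero] at hroot
  rcases hroot with (h0 | h0) | h0
  · exact Or.inl h0
  · exact absurd h0 hqz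
  · exact Or.inr h0

/-- **Goldring's Theorem 3.2, verbatim as an equivalence** ("Equality holds in (3.0.6) if and only if
`f/g` is a Belyi map for `ℙ¹` and `(f/g)(∞) ∈ {0, 1, ∞}`"), in the tree's pair language: `(p, q)` is
a Belyi pair of degree `d` (coprime, `max (deg p) (deg q) = d`, `∞` special, and the Mason–Stothers
count `#Z(p·q·(p−q)) = d + 1` attained) iff it is coprime of degree `d` with `∞` special and all
finite critical values of `p/q` in `{0, 1}`. [cite: Goldring2011, Thm 3.2] -/
theorem isBelyiPair_iff_criticalValues :
    IsBelyiPair d p q ↔ IsCoprime p q ∧ max p.natDegree q.natDegree = d ∧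
      (p.natDegree < d ∨ q.natDegree < d ∨ (p - q).natDegree < d) ∧
      ∀ z : K, q.eval z ≠ 0 → (wronskian p q).eval z = 0 → p.eval z = 0 ∨ p.eval z = q.eval z :=
  ⟨fun h => ⟨h.isCoprime, h.natDegree_eq, h.drop, h.criticalValues⟩,
    fun ⟨hcop, hmax, hdrop, hcrit⟩ => isBelyiPair_of_criticalValues hcop hmax hdrop hcrit⟩

end GoldringIff

/-! ### The count in the clause format of the noncritical Belyi map over `ℚ` (appended) -/

section NoncriticalRational

/-- **`|β⁻¹{0,1,∞}| = deg β + 2` for a Belyi map `β = p/q` over `ℚ` noncritical at `∞`**, in the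
exact clause format of the tree's noncritical Belyi map on `ℙ¹` (`NoncriticalBelyi…`, route
`IUTThetaPilot` / `GenEllTwo` W6): `p, q ∈ ℚ[X]` coprime of degree `n ≥ 1` with `deg (p − q) = n`
(`β(∞) ∉ {0, 1, ∞}`), `p_{n−1} q_n ≠ p_n q_{n−1}` (`β` unramified at `∞`), and — read in `ℂ` via
`aeval` — every `z` with `q(z) ≠ 0`, `(p′q − pq′)(z) = 0` has `p(z) ∈ {0, q(z)}`.  Then
`p · q · (p − q)` has exactly `n + 2` distinct complex roots. [cite: ScherrZieve2014, Prop 9 (proof)] -/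
theorem card_roots_map_eq_add_two_of_noncriticalClauses {p q : ℚ[X]} {n : ℕ} (hn : 0 < n)
    (hp : p.natDegree = n) (hq : q.natDegree = n) (hpq : (p - q).natDegree = n)
    (hcoeff : p.coeff (n - 1) * q.coeff n ≠ p.coeff n * q.coeff (n - 1)) (hcop : IsCoprime p q)
    (hcrit : ∀ z : ℂ, aeval z q ≠ 0 → aeval z (derivative p * q - p * derivative q) = 0 →
      aeval z p = 0 ∨ aeval z p = aeval z q) :
    ((p * q * (p - q)).map (algebraMap ℚ ℂ)).roots.toFinset.card = n + 2 := by
  have hinj : Function.Injective (algebraMap ℚ ℂ) := (algebraMap ℚ ℂ).injective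
  set P := p.map (algebraMap ℚ ℂ) with hP
  set Q := q.map (algebraMap ℚ ℂ) with hQ
  have hPn : P.natDegree = n := by rw [hP, natDegree_map_eq_of_injective hinj, hp]
  have hQn : Q.natDegree = n := by rw [hQ, natDegree_map_eq_of_injective hinj, hq]
  have hPQn : (P - Q).natDegree = n := by
    rw [hP, hQ, ← Polynomial.map_sub, natDegree_map_eq_of_injective hinj, hpq]
  have hcopC : IsCoprime P Q := hcop.map (mapRingHom (algebraMap ℚ ℂ))
  -- the unramified-at-`∞` condition transported to `ℂ`
  have hcoeffC : P.coeff (n - 1) * Q.leadingCoeff ≠ P.leadingCoeff * Q.coeff (n - 1) := by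
    rw [leadingCoeff, leadingCoeff, hPn, hQn, hP, hQ, coeff_map, coeff_map, coeff_map, coeff_map,
      ← map_mul, ← map_mul]
    exact fun h => hcoeff (hinj h)
  have hinf := (natDegree_sub_C_mul_eq_iff_coeff hcopC hPn hQn hn).mpr hcoeffC
  have hmap : (p * q * (p - q)).map (algebraMap ℚ ℂ) = P * Q * (P - Q) := by
    rw [Polynomial.map_mul, Polynomial.map_mul, Polynomial.map_sub]
  rw [hmap]
  refine card_roots_eq_add_two_of_unramified_infty hcopC hPn hQn hPQn hn hinf fun z hqz hWz => ?_
  have hq' : aeval z q ≠ 0 := by rwa [← eval_map_algebraMap]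
  have hW' : aeval z (derivative p * q - p * derivative q) = 0 := by
    rw [← eval_map_algebraMap, Polynomial.map_sub, Polynomial.map_mul, Polynomial.map_mul,
      ← derivative_map, ← derivative_map, ← hP, ← hQ,
      derivative_mul_sub_mul_derivative_eq_neg_wronskian,
      eval_neg, neg_eq_zero]
    exact hWz
  rcases hcrit z hq' hW' with h | h
  · left; rwa [← eval_map_algebraMap] at h
  · right; rwa [← eval_map_algebraMap, ← eval_map_algebraMap] at h

/-- The same count as a statement about the root SET in `ℂ`: `#(p·q·(p−q)).rootSet ℂ = n + 2`.
[cite: ScherrZieve2014, Prop 9 (proof)] -/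
theorem ncard_rootSet_eq_add_two_of_noncriticalClauses {p q : ℚ[X]} {n : ℕ} (hn : 0 < n)
    (hp : p.natDegree = n) (hq : q.natDegree = n) (hpq : (p - q).natDegree = n)
    (hcoeff : p.coeff (n - 1) * q.coeff n ≠ p.coeff n * q.coeff (n - 1)) (hcop : IsCoprime p q)
    (hcrit : ∀ z : ℂ, aeval z q ≠ 0 → aeval z (derivative p * q - p * derivative q) = 0 →
      aeval z p = 0 ∨ aeval z p = aeval z q) :
    ((p * q * (p - q)).rootSet ℂ).ncard = n + 2 := by
  rw [rootSet_def, Set.ncard_coe_finset, aroots_def,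
    card_roots_map_eq_add_two_of_noncriticalClauses hn hp hq hpq hcoeff hcop hcrit]

/-- **Transport of the count to any splitting field.**  If `F` is a field of characteristic `0`
embedding into `ℂ` (e.g. a number field) over which `p · q · (p − q)` splits, then the number of its
distinct roots in `F` is also `n + 2` — the form in which the fibre `B = β⁻¹{0,1,∞}` is handled as a
finite set of algebraic numbers of a number field (GENELLTWO-P1ROUTE §3 (d)(e): `|B| = deg β + 2`).
[cite: ScherrZieve2014, Prop 9 (proof)] -/
theorem card_roots_map_eq_add_two_of_noncriticalClauses_of_splits {F : Type*} [Field F] [CharZero F]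
    [DecidableEq F] (σ : F →+* ℂ) {p q : ℚ[X]} {n : ℕ} (hn : 0 < n)
    (hp : p.natDegree = n) (hq : q.natDegree = n) (hpq : (p - q).natDegree = n)
    (hcoeff : p.coeff (n - 1) * q.coeff n ≠ p.coeff n * q.coeff (n - 1)) (hcop : IsCoprime p q)
    (hcrit : ∀ z : ℂ, aeval z q ≠ 0 → aeval z (derivative p * q - p * derivative q) = 0 →
      aeval z p = 0 ∨ aeval z p = aeval z q)
    (hsplit : ((p * q * (p - q)).map (algebraMap ℚ F)).Splits) :
    ((p * q * (p - q)).map (algebraMap ℚ F)).roots.toFinset.card = n + 2 := by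
  have hcomp : σ.comp (algebraMap ℚ F) = algebraMap ℚ ℂ := Subsingleton.elim _ _
  have hmap : ((p * q * (p - q)).map (algebraMap ℚ F)).map σ = (p * q * (p - q)).map (algebraMap ℚ ℂ) := by
    rw [Polynomial.map_map, hcomp]
  rw [← card_roots_map_eq_add_two_of_noncriticalClauses hn hp hq hpq hcoeff hcop hcrit, ← hmap,
    hsplit.roots_map σ, Multiset.toFinset_map, Finset.card_image_of_injective _ σ.injective]

end NoncriticalRational

end Literature.NumberTheory.DiophantineGeometry
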